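import Summits.CriticalPhenomena.CardyFormulaZ2.Theorems.CardyFlipRussoCoveringLegRobustDefs
import Summits.CriticalPhenomena.CardyFormulaZ2.Theorems.CardyFlipRussoCoveringLegStubCoveringBridge
import Literature.Probability.Percolation.TriHexLemma
import HarnessLib

/-!
# Stub `stub_flipBound` of line `five-arm-null` (skeleton v5) of the crux `CardyFlipRusso.CoveringLeg`
(stmt-CriticalPhenomena-6435)

Helper file `--supports stmt-CriticalPhenomena-6435`, proving EXACTLY the registered statement
`Sig.stub_flipBound` of `CardyFlipRussoCoveringLegRobustDefs.lean`:

* **flip invariance** — at `q = ½` Beffara's mixed law is `lawP half = sitePercolation MixedSite half`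
  (`lawP_half`), which is invariant under the flip `ω ↦ ωᶜ` (`sitePercolation_real_preimage_compl` and
  `unitInterval.symm half = half`), so `P_{1/2}({ω | ωᶜ ∈ S}) = P_{1/2}(S)` for every event `S`
  (`flip_lawP_half_real_preimage_compl`);
* **the complement bound** — the crude crossing event `C := crossS (N + a) δ` is measurable
  (`cover_measurableSet_crossS`), hence so is `compl ⁻¹' C`; an event `E` missed by every configuration whose
  complement lies in `C` is contained in `(compl ⁻¹' C)ᶜ`, so `P(E) ≤ 1 − P(compl ⁻¹' C) = 1 − P(C)`.

Sources: B. Bollobás, O. Riordan, *Percolation* (2006), Ch. 5 Lemma 7 (at `p = ½` the closed sites form a site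
percolation with the same law) [BollobasRiordan2006]; V. Beffara, *Is critical 2D percolation universal?* (2008)
§5.1 [Beffara2008Universal].
-/

noncomputable section

namespace Summit.CriticalPhenomena.CardyFormulaZ2.Cruxes.CoveringLeg.FiveArmNull

open Set MeasureTheory
open Literature.Probability.RandomPlanarGeometry Literature.Probability.Percolation
open Literature.Barriers.CriticalPhenomena (MixedSite)

/-- **Flip invariance of the critical mixed law**: `P_{1/2}({ω | ωᶜ ∈ S}) = P_{1/2}(S)` for every event `S`
(`lawP half` is the homogeneous site percolation at `½`, whose image under `ω ↦ ωᶜ` is the site percolation at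
`1 − ½ = ½`). [cite: BollobasRiordan2006, Ch. 5 Lemma 7] -/
theorem flip_lawP_half_real_preimage_compl (S : Set (Set MixedSite)) :
    (lawP half).real (compl ⁻¹' S) = (lawP half).real S := by
  rw [lawP_half, sitePercolation_real_preimage_compl,
    Literature.Barriers.CriticalPhenomena.unitInterval_symm_half]

/-- **Complement bound**: if `C` is measurable and no configuration whose complement lies in `C` belongs to
`E`, then `P_{1/2}(E) ≤ 1 − P_{1/2}({ω | ωᶜ ∈ C})` (`E ⊆ (compl ⁻¹' C)ᶜ` and `lawP half` is a probability
measure). [folklore] -/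
theorem flip_real_le_one_sub {E C : Set (Set MixedSite)} (hC : MeasurableSet C)
    (hE : ∀ ω : Set MixedSite, ωᶜ ∈ C → ω ∉ E) :
    (lawP half).real E ≤ 1 - (lawP half).real (compl ⁻¹' C) := by
  haveI := isProbabilityMeasure_lawP half
  have hcm : Measurable (compl : Set MixedSite → Set MixedSite) :=
    measurable_set_iff.2 fun i => (measurable_set_mem i).not
  have hsub : E ⊆ (compl ⁻¹' C)ᶜ := fun ω hω hωC => hE ω hωC hω
  calc (lawP half).real E ≤ (lawP half).real (compl ⁻¹' C)ᶜ := measureReal_mono hsub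
    _ = 1 - (lawP half).real (compl ⁻¹' C) := by
      rw [measureReal_compl (hcm hC), probReal_univ]

/-- **Stub `stub_flipBound`** (registered statement `Sig.stub_flipBound`, proved exactly): for every conformal
rectangle `N`, mesh `δ > 0`, translation `a` and event `E` missed by every configuration whose COMPLEMENT has a
crude frame-B crossing of `N + a`, `P_{1/2}(E) ≤ 1 − P_{1/2}[crude crossing of N + a]` — the complement bound
plus flip invariance of site percolation on `G_s` at `p = ½`. [cite: BollobasRiordan2006, Ch. 5 Lemma 7] -/
theorem stub_flipBound : Summit.CriticalPhenomena.CardyFormulaZ2.Cruxes.CoveringLeg.FiveArmNull.Sig.stub_flipBound := by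
  intro N δ hδ a E hE
  have h := flip_real_le_one_sub (cover_measurableSet_crossS (N.map (similarity 1 one_ne_zero a)) hδ.ne') hE
  rwa [flip_lawP_half_real_preimage_compl] at h

end Summit.CriticalPhenomena.CardyFormulaZ2.Cruxes.CoveringLeg.FiveArmNull

end
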